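import Mathlib
import Summits.AtomisticToContinuum.HydrodynamicLimit.Theorems.JaynesSqueezeEntropicWeakStrongHSShellB
import Literature.MathematicalPhysics.KineticTheory.HardSphereEuler
import HarnessLib

/-!
# `EntropicWeakStrongHS` (stmt-AtomisticToContinuum-13461), part C: the abstract shell for data
# continuous on `[0, t] × 𝕋³` only

`shell`: the abstract Dafermos stability shell `shell_core` (part B) with the classical data
`U, lam, Dτ, D i` only assumed jointly continuous on `[0, t] × 𝕋³` (which is all a classical
solution on `[0, T)`, `t < T`, provides). Reduction: compose the data with the retraction
`s ↦ max 0 (min t s)` of `ℝ` onto `[0, t]`; every hypothesis and conclusion only evaluates the data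
at times in `[0, t]`.
-/

noncomputable section

open MeasureTheory Set Filter Function
open scoped BigOperators Topology

namespace Summit.AtomisticToContinuum.HydrodynamicLimit.Theorems.EntropicWeakStrong

open Literature.MathematicalPhysics.KineticTheory (T3 V3)

/-- Composing a field continuous on `[0, t] × 𝕋³` with the retraction onto `[0, t]` in time gives
a globally continuous field. -/
theorem continuous_uncurry_retract {E : Type*} [TopologicalSpace E] {t : ℝ} (ht : 0 ≤ t)
    {U : ℝ → T3 → E} (hU : ContinuousOn (uncurry U) (Icc 0 t ×ˢ univ)) :
    Continuous (uncurry fun s => U (max 0 (min t s))) := by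
  have hπc : Continuous fun s : ℝ => max 0 (min t s) :=
    continuous_const.max (continuous_const.min continuous_id)
  have hmem : ∀ s : ℝ, max 0 (min t s) ∈ Icc 0 t :=
    fun s => ⟨le_max_left _ _, max_le ht (min_le_left _ _)⟩
  have h : (uncurry fun s => U (max 0 (min t s))) =
      uncurry U ∘ fun p : ℝ × T3 => (max 0 (min t p.1), p.2) := by
    funext p; rfl
  rw [h]
  exact hU.comp_continuous (hπc.fst'.prodMk continuous_snd) fun p => ⟨hmem p.1, mem_univ _⟩

/-- **Abstract Dafermos stability shell** for classical data jointly continuous on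
`[0, t] × 𝕋³`. See `shell_core` and the module docstring. -/
theorem shell {t : ℝ} (ht : 0 ≤ t) {K : Set (ℝ × V3 × ℝ)} (hK : IsCompact K)
    (pair : (ℝ × V3 × ℝ) → (ℝ × V3 × ℝ) → ℝ)
    (hpair : pair = fun L U => L.1 * U.1 + (∑ j, L.2.1 j * U.2.1 j) + L.2.2 * U.2.2)
    {U lam Dτ : ℝ → T3 → (ℝ × V3 × ℝ)} {D : Fin 3 → ℝ → T3 → (ℝ × V3 × ℝ)}
    {h : (ℝ × V3 × ℝ) → ℝ} {flux : Fin 3 → (ℝ × V3 × ℝ) → (ℝ × V3 × ℝ)}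
    (hU : ContinuousOn (uncurry U) (Icc 0 t ×ˢ univ))
    (hlam : ContinuousOn (uncurry lam) (Icc 0 t ×ˢ univ))
    (hDτ : ContinuousOn (uncurry Dτ) (Icc 0 t ×ˢ univ))
    (hD : ∀ i, ContinuousOn (uncurry (D i)) (Icc 0 t ×ˢ univ))
    (hhU : ContinuousOn (fun p : ℝ × T3 => h (U p.1 p.2)) (Icc 0 t ×ˢ univ))
    (hfU : ∀ i, ContinuousOn (fun p : ℝ × T3 => flux i (U p.1 p.2)) (Icc 0 t ×ˢ univ))
    (hhK : ContinuousOn h K) (hfK : ∀ i, ContinuousOn (flux i) K)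
    (hΓ : ∀ s ∈ Icc 0 t, (∫ x, h (U s x)) - (∫ x, h (U 0 x)) =
      (∫ x, pair (lam s x) (U s x)) - (∫ x, pair (lam 0 x) (U 0 x)) -
        ∫ τ in (0:ℝ)..s, ∫ x, (pair (Dτ τ x) (U τ x) + ∑ i, pair (D i τ x) (flux i (U τ x))))
    {C₁ C₂ : ℝ} (hC₁ : 0 ≤ C₁) (hC₂ : 0 ≤ C₂)
    (hnonneg : ∀ τ ∈ Icc 0 t, ∀ x, ∀ V ∈ K, 0 ≤ h V - h (U τ x) - pair (lam τ x) (V - U τ x))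
    (hquad : ∀ τ ∈ Icc 0 t, ∀ x, ∀ V ∈ K,
      |pair (Dτ τ x) (V - U τ x) + ∑ i, pair (D i τ x) (flux i V - flux i (U τ x))| ≤
        C₁ * (h V - h (U τ x) - pair (lam τ x) (V - U τ x)))
    (hcoer : ∀ τ ∈ Icc 0 t, ∀ x, ∀ V ∈ K,
      (V.1 - (U τ x).1) ^ 2 + ‖V.2.1 - (U τ x).2.1‖ ^ 2 + (V.2.2 - (U τ x).2.2) ^ 2 ≤
        C₂ * (h V - h (U τ x) - pair (lam τ x) (V - U τ x))) :
    ∀ ε : ℝ, 0 < ε → ∃ δ : ℝ, 0 < δ ∧ ∀ V : ℝ → T3 → (ℝ × V3 × ℝ), Measurable (uncurry V) →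
      (∀ s x, V s x ∈ K) →
      (∀ s ∈ Icc 0 t, ∫ x, h (V s x) ≤ (∫ x, h (U 0 x)) + δ) →
      (∫ x, ((V 0 x).1 - (U 0 x).1) ^ 2 + ‖(V 0 x).2.1 - (U 0 x).2.1‖ ^ 2 +
          ((V 0 x).2.2 - (U 0 x).2.2) ^ 2) ≤ δ →
      (∀ s ∈ Icc 0 t, |(∫ x, pair (lam s x) (V s x)) - (∫ x, pair (lam 0 x) (V 0 x)) -
        ∫ τ in (0:ℝ)..s, ∫ x, (pair (Dτ τ x) (V τ x) +
          ∑ i, pair (D i τ x) (flux i (V τ x)))| ≤ δ) →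
      ∀ s ∈ Icc 0 t, (∫ x, ((V s x).1 - (U s x).1) ^ 2 + ‖(V s x).2.1 - (U s x).2.1‖ ^ 2 +
          ((V s x).2.2 - (U s x).2.2) ^ 2) ≤ ε := by
  intro ε hε
  -- the retraction and the retracted data
  set π : ℝ → ℝ := fun s => max 0 (min t s) with hπ
  have hπid : ∀ s ∈ Icc 0 t, π s = s := fun s hs => by
    simp only [hπ, min_eq_right hs.2, max_eq_right hs.1]
  have hπmem : ∀ s : ℝ, π s ∈ Icc 0 t :=
    fun s => ⟨le_max_left _ _, max_le ht (min_le_left _ _)⟩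
  have h0t : (0:ℝ) ∈ Icc 0 t := ⟨le_rfl, ht⟩
  have hπ0 : π 0 = 0 := hπid 0 h0t
  set U' : ℝ → T3 → (ℝ × V3 × ℝ) := fun s => U (π s) with hU'
  set lam' : ℝ → T3 → (ℝ × V3 × ℝ) := fun s => lam (π s) with hlam'
  set Dτ' : ℝ → T3 → (ℝ × V3 × ℝ) := fun s => Dτ (π s) with hDτ'
  set D' : Fin 3 → ℝ → T3 → (ℝ × V3 × ℝ) := fun i s => D i (π s) with hD'
  have eU : ∀ s ∈ Icc 0 t, U' s = U s := fun s hs => by simp only [hU', hπid s hs]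
  have elam : ∀ s ∈ Icc 0 t, lam' s = lam s := fun s hs => by simp only [hlam', hπid s hs]
  have eDτ : ∀ s ∈ Icc 0 t, Dτ' s = Dτ s := fun s hs => by simp only [hDτ', hπid s hs]
  have eD : ∀ i, ∀ s ∈ Icc 0 t, D' i s = D i s := fun i s hs => by simp only [hD', hπid s hs]
  have eU0 : U' 0 = U 0 := eU 0 h0t
  have elam0 : lam' 0 = lam 0 := elam 0 h0t
  -- global continuity of the retracted data
  have cU : Continuous (uncurry U') := continuous_uncurry_retract ht hU
  have clam : Continuous (uncurry lam') := continuous_uncurry_retract ht hlam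
  have cDτ : Continuous (uncurry Dτ') := continuous_uncurry_retract ht hDτ
  have cD : ∀ i, Continuous (uncurry (D' i)) := fun i => continuous_uncurry_retract ht (hD i)
  have chU : Continuous (fun p : ℝ × T3 => h (U' p.1 p.2)) :=
    continuous_uncurry_retract ht (U := fun s x => h (U s x)) hhU
  have cfU : ∀ i, Continuous (fun p : ℝ × T3 => flux i (U' p.1 p.2)) := fun i =>
    continuous_uncurry_retract ht (U := fun s x => flux i (U s x)) (hfU i)
  -- the time integrals only see times in `[0, s] ⊆ [0, t]`
  have hint : ∀ (W : ℝ → T3 → (ℝ × V3 × ℝ)), ∀ s ∈ Icc 0 t,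
      ∫ τ in (0:ℝ)..s, ∫ x, (pair (Dτ' τ x) (W τ x) + ∑ i, pair (D' i τ x) (flux i (W τ x))) =
      ∫ τ in (0:ℝ)..s, ∫ x, (pair (Dτ τ x) (W τ x) + ∑ i, pair (D i τ x) (flux i (W τ x))) := by
    intro W s hs
    refine intervalIntegral.integral_congr fun τ hτ => ?_
    rw [uIcc_of_le hs.1] at hτ
    have hτt : τ ∈ Icc 0 t := ⟨hτ.1, hτ.2.trans hs.2⟩
    simp only [eDτ τ hτt, eD _ τ hτt]
  have hintU : ∀ s ∈ Icc 0 t,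
      ∫ τ in (0:ℝ)..s, ∫ x, (pair (Dτ' τ x) (U' τ x) + ∑ i, pair (D' i τ x) (flux i (U' τ x))) =
      ∫ τ in (0:ℝ)..s, ∫ x, (pair (Dτ τ x) (U τ x) + ∑ i, pair (D i τ x) (flux i (U τ x))) := by
    intro s hs
    refine intervalIntegral.integral_congr fun τ hτ => ?_
    rw [uIcc_of_le hs.1] at hτ
    have hτt : τ ∈ Icc 0 t := ⟨hτ.1, hτ.2.trans hs.2⟩
    simp only [eDτ τ hτt, eD _ τ hτt, eU τ hτt]
  -- transported hypotheses
  have hΓ' : ∀ s ∈ Icc 0 t, (∫ x, h (U' s x)) - (∫ x, h (U' 0 x)) =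
      (∫ x, pair (lam' s x) (U' s x)) - (∫ x, pair (lam' 0 x) (U' 0 x)) -
        ∫ τ in (0:ℝ)..s, ∫ x, (pair (Dτ' τ x) (U' τ x) +
          ∑ i, pair (D' i τ x) (flux i (U' τ x))) := by
    intro s hs
    rw [hintU s hs, eU s hs, eU0, elam s hs, elam0]
    exact hΓ s hs
  have hnonneg' : ∀ τ ∈ Icc 0 t, ∀ x, ∀ V ∈ K,
      0 ≤ h V - h (U' τ x) - pair (lam' τ x) (V - U' τ x) := by
    intro τ hτ x V hV; rw [eU τ hτ, elam τ hτ]; exact hnonneg τ hτ x V hV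
  have hquad' : ∀ τ ∈ Icc 0 t, ∀ x, ∀ V ∈ K,
      |pair (Dτ' τ x) (V - U' τ x) + ∑ i, pair (D' i τ x) (flux i V - flux i (U' τ x))| ≤
        C₁ * (h V - h (U' τ x) - pair (lam' τ x) (V - U' τ x)) := by
    intro τ hτ x V hV
    simp only [eU τ hτ, elam τ hτ, eDτ τ hτ, eD _ τ hτ]
    exact hquad τ hτ x V hV
  have hcoer' : ∀ τ ∈ Icc 0 t, ∀ x, ∀ V ∈ K,
      (V.1 - (U' τ x).1) ^ 2 + ‖V.2.1 - (U' τ x).2.1‖ ^ 2 + (V.2.2 - (U' τ x).2.2) ^ 2 ≤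
        C₂ * (h V - h (U' τ x) - pair (lam' τ x) (V - U' τ x)) := by
    intro τ hτ x V hV; rw [eU τ hτ, elam τ hτ]; exact hcoer τ hτ x V hV
  obtain ⟨δ, hδ, key⟩ := shell_core ht hK pair hpair cU clam cDτ cD chU cfU hhK hfK hΓ' hC₁ hC₂
    hnonneg' hquad' hcoer' ε hε
  refine ⟨δ, hδ, fun V hVm hVK hent hd0 hW s hs => ?_⟩
  have hent' : ∀ s ∈ Icc 0 t, ∫ x, h (V s x) ≤ (∫ x, h (U' 0 x)) + δ := by
    intro s' hs'; rw [eU0]; exact hent s' hs'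
  have hd0' : (∫ x, ((V 0 x).1 - (U' 0 x).1) ^ 2 + ‖(V 0 x).2.1 - (U' 0 x).2.1‖ ^ 2 +
      ((V 0 x).2.2 - (U' 0 x).2.2) ^ 2) ≤ δ := by rw [eU0]; exact hd0
  have hW' : ∀ s ∈ Icc 0 t, |(∫ x, pair (lam' s x) (V s x)) - (∫ x, pair (lam' 0 x) (V 0 x)) -
      ∫ τ in (0:ℝ)..s, ∫ x, (pair (Dτ' τ x) (V τ x) +
        ∑ i, pair (D' i τ x) (flux i (V τ x)))| ≤ δ := by
    intro s' hs'
    rw [hint V s' hs', elam s' hs', elam0]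
    exact hW s' hs'
  have := key V hVm hVK hent' hd0' hW' s hs
  rwa [eU s hs] at this

end Summit.AtomisticToContinuum.HydrodynamicLimit.Theorems.EntropicWeakStrong

end
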